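import Literature.Algebra.Homology.DiscreteRepLayerColimitDesc
import Literature.NumberTheory.GaloisRepresentations.GaloisCohomologyLayerInflationCup
import HarnessLib

/-!
# `Ext¹_{C_Γ}(ℤ, M) ≅ H¹(K, M)` BY INFLATION: the additive bijection `Φ` descending the native layer inflations
# `H¹(Γ_K ⧸ U, M^U) → H¹_cont(Γ_K, M)` along door-c4's colimit presentation `Ext¹_{C_Γ}(ℤ, M) = lim→_U H¹(Γ_K ⧸ U, M^U)`
# (Serre, *Galois Cohomology* I §2.2 Prop. 8 and Cor. 1; §2.6 (b))

Topic `NumberTheory/GaloisRepresentations`; namespace `Literature.NumberTheory.GaloisRepresentations.OpenLayer`.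
Definitions with bodies (`infOpen`, `inflateOpenCocycle`, `extOneToGaloisCohomology`, `extOneEquiv`) and theorems;
NO named fact, no instance, no notation, no `sorry`.  One LOCAL instance attribute (`absoluteGaloisGroup_compactSpace`,
the tree's theorem — the colimit theorem needs `Γ_K` profinite).

THE MATHEMATICS.  For a discrete `Γ_K`-module `ρ` on `M` and an open normal subgroup `U ⊴ Γ_K`, the layer
`M^U` is a module over the finite discrete group `Γ_K ⧸ U`; Mathlib's `H¹(Γ_K ⧸ U, M^U)` (`groupCohomology` of
`(invariantsQuotFunctor ℤ U).obj (ofDiscreteGaloisModule ρ)`, which is DEFINITIONALLY `Rep.of` of the tree's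
`ρ.quotientInvariants U`) inflates to the continuous `H¹(K, M) = galoisCohomology ρ 1` (**`infOpen ρ U`**: the tree's
`galoisCohomology.inf` after the discrete/continuous comparison `H1DiscreteEquiv`; cocycle formula **`infOpen_H1π`**:
`inf [f] = [σ ↦ f(σ̄)]`).  These maps are injective (inflation–restriction, `galoisCohomology.inf_one_injective_holds`)
and compatible with the inflation transitions `stepG U V` between layers (**`infOpen_stepG`**) — i.e. they form a
compatible family on ALL open normal subgroups in the sense of `LayerColimit.IsCompatibleFamily` — and every class of
`H¹(K, M)` is inflated from some layer (`exists_infOneLayer_eq`, Serre I §2.2 Cor. 1).  By the universal property of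
door-c4's colimit presentation `Ext¹_{C_Γ}(ℤ, M) = lim→_U H¹(Γ_K ⧸ U, M^U)` (`LayerColimit.desc`, `desc_inflG`,
`desc_bijective`) they therefore descend to an additive BIJECTION

  **`Φ = extOneToGaloisCohomology ρ : Ext¹_{C_Γ}(ℤ, M) →+ H¹(K, M)`,  `Φ (inflG U [f]) = [σ ↦ f(σ̄)]`**

(`extOneToGaloisCohomology_inflG(_H1π)`, `extOneToGaloisCohomology_bijective`, `extOneEquiv`).  This is the degree-`1`
comparison in the currency the presentation road of the Poitou–Tate programme uses (door-c4's layer classes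
`inflG U_E (presentationComplex ρ).X₃ 1 [γ]` on the `Ext` side, inflated cocycle classes `[σ ↦ γ(σ̄)]` on the native side):
it supplies the bijection `nat` of bsd-wall's Ш²-readout road to PT2 (`shaTwo_tateDual_of_ideleProjection`) WITHOUT the
unproved dictionary «`extTrivAddEquivGaloisCohomology ρ 1 ∘ inflG = inflation`» for the abstract `δ`-functor comparison.
HONEST FRAMING: homological bookkeeping over the cited files; no arithmetic statement and no case of BSD is proved here.
Written for crux `stmt-BirchSwinnertonDyer-19295` (`AnticycControlAdditiveK`, cell `bsd-schneider-ideate`, seat door-c5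
gen 18), input «nat» of the (R4=) reciprocity equality.

## References
* J.-P. Serre, *Galois Cohomology* (1997), I §2.2 Proposition 8 and Corollary 1 (`H^q(G, A) = lim→ H^q(G/U, A^U)`),
  I §2.6 (b) (inflation–restriction in degree `1`). [SerreGaloisCohomology1997]
* J. Neukirch, A. Schmidt, K. Wingberg, *Cohomology of Number Fields* (2008), (1.5.1), (1.6.7). [NeukirchSchmidtWingberg2008]
* D. Harari, *Galois Cohomology and Class Field Theory* (2020), §4.3 Proposition 4.18, Remark 4.24. [Harari2020]
-/

noncomputable section

open CategoryTheory CategoryTheory.Abelian groupCohomology Function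
open Field (absoluteGaloisGroup)
open Literature.Algebra.Homology Literature.Algebra.Homology.DiscreteRep

namespace Literature.NumberTheory.GaloisRepresentations

namespace OpenLayer

-- the colimit theorem needs `Γ_K` compact (profinite); the tree's theorem, local, no override.
attribute [local instance] absoluteGaloisGroup_compactSpace

variable {K : Type} [Field K]
variable {M : Type} [AddCommGroup M] [TopologicalSpace M] [DiscreteTopology M] (ρ : DiscreteGaloisModule K M)

/-! ## §1 The layer inflation `H¹(Γ_K ⧸ U, M^U) → H¹(K, M)` for an open normal subgroup `U` -/

/-- The layer `M^U` of the colimit presentation IS (`rfl`) `Rep.of` of the tree's `ρ.quotientInvariants U`.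
[cite: SerreGaloisCohomology1997, I §2.2 Proposition 8] -/
theorem layer_eq (U : OpenNormalSubgroup (absoluteGaloisGroup K)) :
    (invariantsQuotFunctor ℤ (U : Subgroup (absoluteGaloisGroup K))).obj (ofDiscreteGaloisModule ρ) =
      Rep.of (ρ.quotientInvariants (U : Subgroup (absoluteGaloisGroup K))).toRepresentation := rfl

/-- **The layer inflation `inf_U : H¹(Γ_K ⧸ U, M^U) →+ H¹(K, M)`** from Mathlib's `groupCohomology` of the layer of the
colimit presentation (discrete/continuous comparison `H1DiscreteEquiv`, then the tree's `galoisCohomology.inf`).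
[cite: SerreGaloisCohomology1997, I §2.2 Proposition 8][cite: NeukirchSchmidtWingberg2008, (1.5.1)] -/
def infOpen (U : OpenNormalSubgroup (absoluteGaloisGroup K)) :
    groupCohomology ((invariantsQuotFunctor ℤ (U : Subgroup (absoluteGaloisGroup K))).obj (ofDiscreteGaloisModule ρ)) 1 →+
      galoisCohomology ρ 1 :=
  haveI : DiscreteTopology (absoluteGaloisGroup K ⧸ (U : Subgroup (absoluteGaloisGroup K))) :=
    QuotientGroup.discreteTopology U.isOpen
  (galoisCohomology.inf ρ (U : Subgroup (absoluteGaloisGroup K)) 1).comp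
    (H1DiscreteEquiv (ρ.quotientInvariants (U : Subgroup (absoluteGaloisGroup K))).toRepresentation
      (ρ.quotientInvariants (U : Subgroup (absoluteGaloisGroup K))).toContRepresentation (fun _ _ => rfl)).toAddMonoidHom

/-- The inflated crossed homomorphism `σ ↦ f(σ̄) ∈ M` of a layer `1`-cocycle `f`, as a continuous `1`-cocycle of `Γ_K`.
[cite: SerreGaloisCohomology1997, I §2.2] -/
def inflateOpenCocycle (U : OpenNormalSubgroup (absoluteGaloisGroup K))
    (f : cocycles₁ ((invariantsQuotFunctor ℤ (U : Subgroup (absoluteGaloisGroup K))).obj (ofDiscreteGaloisModule ρ))) :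
    contOneCocycles ρ.toTopRep :=
  haveI : DiscreteTopology (absoluteGaloisGroup K ⧸ (U : Subgroup (absoluteGaloisGroup K))) :=
    QuotientGroup.discreteTopology U.isOpen
  contOneCocycles.pullback (ContinuousMonoidHom.quotientMk (U : Subgroup (absoluteGaloisGroup K)))
    (X := (ρ.quotientInvariants (U : Subgroup (absoluteGaloisGroup K))).toTopRep) (Y := ρ.toTopRep)
    (TopRep.ofHom ⟨Submodule.subtypeL _, fun _ => rfl⟩)
    (cocycles₁ToContOneCocycles (ρ.quotientInvariants (U : Subgroup (absoluteGaloisGroup K))).toRepresentation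
      (ρ.quotientInvariants (U : Subgroup (absoluteGaloisGroup K))).toContRepresentation (fun _ _ => rfl) f)

/-- Unfolding: `inflateOpenCocycle f σ = f(σ̄)` in `M`. [cite: SerreGaloisCohomology1997, I §2.2] -/
@[simp] theorem inflateOpenCocycle_apply (U : OpenNormalSubgroup (absoluteGaloisGroup K))
    (f : cocycles₁ ((invariantsQuotFunctor ℤ (U : Subgroup (absoluteGaloisGroup K))).obj (ofDiscreteGaloisModule ρ)))
    (σ : absoluteGaloisGroup K) :
    (inflateOpenCocycle ρ U f).1 σ =
      Subtype.val ((f : (absoluteGaloisGroup K ⧸ (U : Subgroup (absoluteGaloisGroup K))) → _)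
        (σ : absoluteGaloisGroup K ⧸ (U : Subgroup (absoluteGaloisGroup K)))) := rfl

/-- **Cocycle formula `inf_U [f] = [σ ↦ f(σ̄)]`.** [cite: SerreGaloisCohomology1997, I §2.2 Proposition 8]
[cite: NeukirchSchmidtWingberg2008, (1.5.1)] -/
theorem infOpen_H1π (U : OpenNormalSubgroup (absoluteGaloisGroup K))
    (f : cocycles₁ ((invariantsQuotFunctor ℤ (U : Subgroup (absoluteGaloisGroup K))).obj (ofDiscreteGaloisModule ρ))) :
    infOpen ρ U (H1π _ f) = oneCocycleClass ρ.toTopRep (inflateOpenCocycle ρ U f) := by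
  haveI : DiscreteTopology (absoluteGaloisGroup K ⧸ (U : Subgroup (absoluteGaloisGroup K))) :=
    QuotientGroup.discreteTopology U.isOpen
  change galoisCohomology.inf ρ (U : Subgroup (absoluteGaloisGroup K)) 1
    (H1DiscreteEquiv (ρ.quotientInvariants (U : Subgroup (absoluteGaloisGroup K))).toRepresentation
      (ρ.quotientInvariants (U : Subgroup (absoluteGaloisGroup K))).toContRepresentation (fun _ _ => rfl)
      (H1π (Rep.of (ρ.quotientInvariants (U : Subgroup (absoluteGaloisGroup K))).toRepresentation) f)) = _
  rw [H1DiscreteEquiv_H1π]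
  exact map_oneCocycleClass (ContinuousMonoidHom.quotientMk (U : Subgroup (absoluteGaloisGroup K)))
    (X := (ρ.quotientInvariants (U : Subgroup (absoluteGaloisGroup K))).toTopRep) (Y := ρ.toTopRep)
    (TopRep.ofHom ⟨Submodule.subtypeL _, fun _ => rfl⟩) _

/-- **`inf_U` is injective** (inflation–restriction in degree `1`; the tree's `galoisCohomology.inf_one_injective_holds`).
[cite: SerreGaloisCohomology1997, I §2.6 (b)][cite: NeukirchSchmidtWingberg2008, (1.6.7)] -/
theorem infOpen_injective (U : OpenNormalSubgroup (absoluteGaloisGroup K)) : Injective (infOpen ρ U) := by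
  have hcl : IsClosed ((U : Subgroup (absoluteGaloisGroup K)) : Set (absoluteGaloisGroup K)) :=
    (U : Subgroup (absoluteGaloisGroup K)).isClosed_of_isOpen U.isOpen
  intro x y hxy
  apply (H1DiscreteEquiv (ρ.quotientInvariants (U : Subgroup (absoluteGaloisGroup K))).toRepresentation
      (ρ.quotientInvariants (U : Subgroup (absoluteGaloisGroup K))).toContRepresentation (fun _ _ => rfl)).injective
  exact galoisCohomology.inf_one_injective_holds K M ρ (U : Subgroup (absoluteGaloisGroup K)) hcl hxy

/-- **Compatibility with the inflation transitions**: `inf_V ∘ Inf_{U → V} = inf_U` for `V ≤ U` (both send `[f]` to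
`[σ ↦ f(σ̄)]`). [cite: SerreGaloisCohomology1997, I §2.2 Proposition 8] -/
theorem infOpen_stepG (U V : OpenNormalSubgroup (absoluteGaloisGroup K))
    (h : (V : Subgroup (absoluteGaloisGroup K)) ≤ U)
    (c : groupCohomology ((invariantsQuotFunctor ℤ (U : Subgroup (absoluteGaloisGroup K))).obj (ofDiscreteGaloisModule ρ)) 1) :
    infOpen ρ V (LayerColimit.stepG U V h (ofDiscreteGaloisModule ρ) 1 c) = infOpen ρ U c := by
  induction c using H1_induction_on with
  | h f =>
    change infOpen ρ V (groupCohomology.map _ _ 1 (H1π _ f)) = _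
    rw [H1π_comp_map_apply, infOpen_H1π, infOpen_H1π]
    exact congrArg _ (Subtype.ext (ContinuousMap.ext fun σ => rfl))

/-- **The layer inflations form a compatible family on all open normal subgroups** (`LayerColimit.IsCompatibleFamily`).
[cite: SerreGaloisCohomology1997, I §2.2 Proposition 8] -/
theorem isCompatibleFamily_infOpen :
    LayerColimit.IsCompatibleFamily (fun U : OpenNormalSubgroup (absoluteGaloisGroup K) => U)
      (ofDiscreteGaloisModule ρ) 1 (fun U => infOpen ρ U) :=
  ⟨fun W => ⟨W, le_rfl⟩, fun U V h c => infOpen_stepG ρ U V h c⟩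

/-! ## §2 The descended map `Φ : Ext¹_{C_Γ}(ℤ, M) →+ H¹(K, M)` and its values on inflated classes -/

/-- **`Φ : Ext¹_{C_Γ}(ℤ, M) →+ H¹(K, M)`**, the layer inflations descended along
`Ext¹_{C_Γ}(ℤ, M) = lim→_U H¹(Γ_K ⧸ U, M^U)` (`LayerColimit.desc`). [cite: SerreGaloisCohomology1997, I §2.2 Proposition 8]
[cite: Harari2020, §4.3 Proposition 4.18] -/
def extOneToGaloisCohomology : Ext (triv (Γ := absoluteGaloisGroup K) ℤ) (ofDiscreteGaloisModule ρ) 1 →+ galoisCohomology ρ 1 :=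
  LayerColimit.desc (fun U : OpenNormalSubgroup (absoluteGaloisGroup K) => U) (ofDiscreteGaloisModule ρ) 1
    (fun U => infOpen ρ U) (isCompatibleFamily_infOpen ρ)

/-- **`Φ (Inf_U c) = inf_U c`.** [cite: SerreGaloisCohomology1997, I §2.2 Proposition 8] -/
theorem extOneToGaloisCohomology_inflG (U : OpenNormalSubgroup (absoluteGaloisGroup K))
    (c : groupCohomology ((invariantsQuotFunctor ℤ (U : Subgroup (absoluteGaloisGroup K))).obj (ofDiscreteGaloisModule ρ)) 1) :
    extOneToGaloisCohomology ρ (LayerColimit.inflG U (ofDiscreteGaloisModule ρ) 1 c) = infOpen ρ U c :=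
  LayerColimit.desc_inflG (V := fun U : OpenNormalSubgroup (absoluteGaloisGroup K) => U) (isCompatibleFamily_infOpen ρ) U c

/-- **`Φ (Inf_U [f]) = [σ ↦ f(σ̄)]`** — the value on a layer cocycle class is the class of the inflated cocycle.
[cite: SerreGaloisCohomology1997, I §2.2 Proposition 8][cite: NeukirchSchmidtWingberg2008, (1.5.1)] -/
theorem extOneToGaloisCohomology_inflG_H1π (U : OpenNormalSubgroup (absoluteGaloisGroup K))
    (f : cocycles₁ ((invariantsQuotFunctor ℤ (U : Subgroup (absoluteGaloisGroup K))).obj (ofDiscreteGaloisModule ρ))) :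
    extOneToGaloisCohomology ρ (LayerColimit.inflG U (ofDiscreteGaloisModule ρ) 1 (H1π _ f)) =
      oneCocycleClass ρ.toTopRep (inflateOpenCocycle ρ U f) := by
  rw [extOneToGaloisCohomology_inflG, infOpen_H1π]

/-- `Φ` evaluated through a cocycle whose values are prescribed: if a continuous `1`-cocycle `z` of `Γ_K` satisfies
`z σ = f(σ̄)` for a layer cocycle `f`, then `Φ (Inf_U [f]) = [z]`. [cite: SerreGaloisCohomology1997, I §2.2 Proposition 8] -/
theorem extOneToGaloisCohomology_inflG_H1π_eq_of_apply (U : OpenNormalSubgroup (absoluteGaloisGroup K))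
    (f : cocycles₁ ((invariantsQuotFunctor ℤ (U : Subgroup (absoluteGaloisGroup K))).obj (ofDiscreteGaloisModule ρ)))
    (z : contOneCocycles ρ.toTopRep)
    (hz : ∀ σ : absoluteGaloisGroup K, z.1 σ =
      Subtype.val ((f : (absoluteGaloisGroup K ⧸ (U : Subgroup (absoluteGaloisGroup K))) → _)
        (σ : absoluteGaloisGroup K ⧸ (U : Subgroup (absoluteGaloisGroup K))))) :
    extOneToGaloisCohomology ρ (LayerColimit.inflG U (ofDiscreteGaloisModule ρ) 1 (H1π _ f)) =
      oneCocycleClass ρ.toTopRep z := by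
  rw [extOneToGaloisCohomology_inflG_H1π]
  exact congrArg _ (Subtype.ext (ContinuousMap.ext fun σ => (hz σ).symm))

/-! ## §3 `Φ` is bijective -/

/-- **`Φ` is injective** (every layer inflation is). [cite: SerreGaloisCohomology1997, I §2.6 (b)]
[cite: Harari2020, §4.3 Proposition 4.18] -/
theorem extOneToGaloisCohomology_injective : Injective (extOneToGaloisCohomology ρ) :=
  LayerColimit.desc_injective (isCompatibleFamily_infOpen ρ) fun U => infOpen_injective ρ U

/-- The open normal subgroup `Gal(K̄/E)` of a finite Galois subextension `E ⊆ K̄`, as an `OpenNormalSubgroup`.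
[cite: NeukirchSchmidtWingberg2008, (1.5.1)] -/
def openNormalSubgroupOf (E : IntermediateField K (AlgebraicClosure K)) [FiniteDimensional K E] [Normal K E] :
    OpenNormalSubgroup (absoluteGaloisGroup K) :=
  { toSubgroup := absGaloisFixingSubgroup E
    isOpen' := isOpen_absGaloisFixingSubgroup K E }

/-- Its underlying subgroup is `absGaloisFixingSubgroup E`. [cite: NeukirchSchmidtWingberg2008, (1.5.1)] -/
theorem coe_openNormalSubgroupOf (E : IntermediateField K (AlgebraicClosure K)) [FiniteDimensional K E] [Normal K E] :
    (openNormalSubgroupOf E : Subgroup (absoluteGaloisGroup K)) = absGaloisFixingSubgroup E := rfl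

/-- On the layer of a finite Galois subextension, `inf_U` IS the tree's `infOneLayer` (definitionally).
[cite: SerreGaloisCohomology1997, I §2.2 Proposition 8] -/
theorem infOpen_openNormalSubgroupOf (E : IntermediateField K (AlgebraicClosure K)) [FiniteDimensional K E] [Normal K E]
    (y : groupCohomology (absGaloisLayerRep K E ρ) 1) :
    infOpen ρ (openNormalSubgroupOf E) y = infOneLayer K E ρ y := rfl

/-- **`Φ` is surjective** (every class of `H¹(K, M)` is inflated from a finite Galois layer, Serre I §2.2 Cor. 1).
[cite: SerreGaloisCohomology1997, I §2.2 Corollary 1] -/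
theorem extOneToGaloisCohomology_surjective : Surjective (extOneToGaloisCohomology ρ) := by
  intro x
  obtain ⟨E, hE, hE', y, hy⟩ := exists_infOneLayer_eq K ρ x
  haveI := hE
  haveI := hE'
  refine ⟨LayerColimit.inflG (openNormalSubgroupOf E) (ofDiscreteGaloisModule ρ) 1 y, ?_⟩
  rw [extOneToGaloisCohomology_inflG]
  exact hy

/-- **`Φ : Ext¹_{C_Γ}(ℤ, M) → H¹(K, M)` is bijective.** [cite: SerreGaloisCohomology1997, I §2.2 Proposition 8, §2.6 (b)]
[cite: Harari2020, §4.3 Proposition 4.18] -/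
theorem extOneToGaloisCohomology_bijective : Bijective (extOneToGaloisCohomology ρ) :=
  ⟨extOneToGaloisCohomology_injective ρ, extOneToGaloisCohomology_surjective ρ⟩

/-- **`Ext¹_{C_Γ}(ℤ, M) ≃+ H¹(K, M)`** (the additive equivalence of `Φ`). [cite: SerreGaloisCohomology1997, I §2.2 Proposition 8]
[cite: Harari2020, §4.3 Proposition 4.18] -/
def extOneEquiv : Ext (triv (Γ := absoluteGaloisGroup K) ℤ) (ofDiscreteGaloisModule ρ) 1 ≃+ galoisCohomology ρ 1 :=
  AddEquiv.ofBijective (extOneToGaloisCohomology ρ) (extOneToGaloisCohomology_bijective ρ)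

/-- `extOneEquiv` is `Φ`. [cite: SerreGaloisCohomology1997, I §2.2 Proposition 8] -/
@[simp] theorem extOneEquiv_apply (x : Ext (triv (Γ := absoluteGaloisGroup K) ℤ) (ofDiscreteGaloisModule ρ) 1) :
    extOneEquiv ρ x = extOneToGaloisCohomology ρ x := rfl

/-- `Φ (Φ⁻¹ y) = y`. [cite: SerreGaloisCohomology1997, I §2.2 Proposition 8] -/
theorem extOneToGaloisCohomology_symm_apply (y : galoisCohomology ρ 1) :
    extOneToGaloisCohomology ρ ((extOneEquiv ρ).symm y) = y :=
  (extOneEquiv ρ).apply_symm_apply y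

/-- **Every class of `H¹(K, M)` is `Φ` of a class inflated from ANY sufficiently small layer**: for `x ∈ H¹(K, M)` and an
open normal `W`, there are `U ≤ W` and a layer class `c ∈ H¹(Γ_K ⧸ U, M^U)` with `Φ (Inf_U c) = x`.
[cite: SerreGaloisCohomology1997, I §2.2 Proposition 8 and Corollary 1] -/
theorem exists_inflG_le_eq (W : OpenNormalSubgroup (absoluteGaloisGroup K)) (x : galoisCohomology ρ 1) :
    ∃ (U : OpenNormalSubgroup (absoluteGaloisGroup K)) (_ : (U : Subgroup (absoluteGaloisGroup K)) ≤ W)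
      (c : groupCohomology ((invariantsQuotFunctor ℤ (U : Subgroup (absoluteGaloisGroup K))).obj (ofDiscreteGaloisModule ρ)) 1),
      extOneToGaloisCohomology ρ (LayerColimit.inflG U (ofDiscreteGaloisModule ρ) 1 c) = x := by
  obtain ⟨e, rfl⟩ := extOneToGaloisCohomology_surjective ρ x
  obtain ⟨U₀, c₀, rfl⟩ := LayerColimit.exists_inflG_eq 1 (ofDiscreteGaloisModule ρ) e
  refine ⟨U₀ ⊓ W, LayerColimit.coe_le_coe_of_le inf_le_right,
    LayerColimit.stepG U₀ (U₀ ⊓ W) (LayerColimit.coe_le_coe_of_le inf_le_left) (ofDiscreteGaloisModule ρ) 1 c₀, ?_⟩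
  rw [LayerColimit.inflG_stepG]

/-- The same with a cocycle representative: `x = Φ (Inf_U [f])` for some `U ≤ W` and layer cocycle `f`.
[cite: SerreGaloisCohomology1997, I §2.2 Proposition 8 and Corollary 1] -/
theorem exists_inflG_H1π_le_eq (W : OpenNormalSubgroup (absoluteGaloisGroup K)) (x : galoisCohomology ρ 1) :
    ∃ (U : OpenNormalSubgroup (absoluteGaloisGroup K)) (_ : (U : Subgroup (absoluteGaloisGroup K)) ≤ W)
      (f : cocycles₁ ((invariantsQuotFunctor ℤ (U : Subgroup (absoluteGaloisGroup K))).obj (ofDiscreteGaloisModule ρ))),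
      extOneToGaloisCohomology ρ (LayerColimit.inflG U (ofDiscreteGaloisModule ρ) 1 (H1π _ f)) = x := by
  obtain ⟨U, hU, c, hc⟩ := exists_inflG_le_eq ρ W x
  induction c using H1_induction_on with
  | h f => exact ⟨U, hU, f, hc⟩

end OpenLayer

end Literature.NumberTheory.GaloisRepresentations
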